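import Mathlib.LinearAlgebra.Matrix.Dual
import Mathlib.LinearAlgebra.Dual.Lemmas
import Mathlib.LinearAlgebra.FiniteDimensional.Lemmas
import Mathlib.LinearAlgebra.StdBasis
import Mathlib.Algebra.Field.ZMod
import HarnessLib

/-!
# Affine systems over `𝔽₂`, coordinate subspaces, and clause sets: the Rado deficiency

Vocabulary for rank ("width") arguments about resolution over parities Res(⊕)
(`Literature.Computability.MetaComplexity.ResLin`, `ResLinWidth`): the negation `¬C` of a linear
clause `C = ⋁ᵢ (fᵢ = aᵢ)` is a LINEAR (affine) SYSTEM `⋀ᵢ (fᵢ = aᵢ + 1)` over `𝔽₂`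
(Efremenko–Garlík–Itsykson 2024, §2.1: a linear system `Φ`, its set of linear forms `L(Φ)`, their
span `⟨L(Φ)⟩`, `rk Φ`; Itsykson–Sokolov 2020, §2), and a clause is falsified exactly by the
assignments agreeing with its FORBIDDEN PATTERN on its variable set. On a finite variable type `V`
(vectors and linear forms both live in `V → ZMod 2`, paired by `dotProduct`):

* `AffSys V` — a finite set of (form, value) pairs; `AffSys.Sol Ψ` its solution set;
  `AffSys.forms Ψ = L(Ψ)`; `AffSys.spanS Ψ = ⟨L(Ψ)⟩`;
* `AffSys.mem_spanS_of_constant` — a form constant on the (nonempty) solution set lies in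
  `⟨L(Ψ)⟩` (double annihilator, via Mathlib's `Subspace.dualCoannihilator_dualAnnihilator_eq`
  and `dotProductEquiv`), whence `AffSys.extend_consistent`: a consistent system stays consistent
  after adding `f = c` for a form `f ∉ ⟨L(Ψ)⟩` and EITHER value `c`;
* `AffSys.coordS A = 𝔽₂^A`, the coordinate subspace of vectors supported in `A`, with
  `finrank (coordS A) = |A|` and `span {eᵢ : i ∈ A} = coordS A`;
* clause sets given by scopes `T : ι → Finset V` and forbidden patterns `a : ι → V → ZMod 2`:
  `VI T I = ⋃_{j ∈ I} T j`, `SatOn` / `PsiSat` (satisfiable together with `Ψ`) /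
  `MinimalPsiUnsat`, and the RADO DEFICIENCY of a clause set relative to a subspace `S`,
  `deltaS T S I = |I| - |V(I)| + dim (S ∩ 𝔽₂^{V(I)})` (`= |I| -` rank of `V(I)` in the quotient
  matroid `𝔽₂^V/S`; Welsh 1976, Ch. 7 (deficiency form of Rado–Hall)), with the sup form and
  the contraction identity `δ_{S + 𝔽₂^{V(I)}}(J) = δ_S(I ∪ J) - δ_S(I)`.

Design: plain `Finset`s and `dotProduct` (no matrices); `V` is any `Fintype` (users take
`V = {v // v ∈ N}` for a finite window `N ⊆ ℕ` of variables). Nothing here is specific to a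
lower-bound argument; the linear Aharoni–Linial lemma and Rado's theorem live elsewhere
(`Literature.Combinatorics.Matroid.RadoIndependentTransversal`, Summits side).

-- adapted from reserve/prior-2001/Prior/PneNP/PneNP/Pnp_Ac0pFregeViaAlgebraicProofs_SafeWalkLAL.lean
-- (2001 programme, Sections 2–3), generalised from `Fin n` to a `Fintype` and with the dot-product
-- duality taken from Mathlib instead of a bespoke `perp`.

## References

* K. Efremenko, M. Garlík, D. Itsykson, *Lower bounds for regular resolution over parities*,
  STOC 2024, §2.1 (linear systems over `𝔽₂`, `L(Φ)`, `⟨L(Φ)⟩`, rank).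
* D. Itsykson, D. Sokolov, *Resolution over linear equations modulo two*, APAL 171 (2020), §2.
* D. J. A. Welsh, *Matroid Theory*, Academic Press 1976, Ch. 7 (transversal theory, deficiency).
-/

namespace Literature.Computability.MetaComplexity

open Finset Submodule Module

/-- An AFFINE (linear) SYSTEM over `𝔽₂` on the variable type `V`: a finite set of pairs
`(f, a)` standing for the equations `⟨f, z⟩ = a`. [Efremenko–Garlík–Itsykson 2024, §2.1
(linear systems `Φ`)] [cite: EfremenkoGarlikItsykson2024, §2.1] -/
abbrev AffSys (V : Type*) : Type _ := Finset ((V → ZMod 2) × ZMod 2)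

namespace AffSys

variable {V : Type*} [Fintype V] [DecidableEq V]

/-! ### Solution set, forms, form span -/

/-- The solution set of an affine system. [Efremenko–Garlík–Itsykson 2024, §2.1]
[cite: EfremenkoGarlikItsykson2024, §2.1] -/
def Sol (Ψ : AffSys V) : Set (V → ZMod 2) := {z | ∀ p ∈ Ψ, p.1 ⬝ᵥ z = p.2}

/-- The set of linear forms `L(Ψ)` of an affine system. [Efremenko–Garlík–Itsykson 2024, §2.1
(`L(Φ)`)] [cite: EfremenkoGarlikItsykson2024, §2.1] -/
def forms (Ψ : AffSys V) : Finset (V → ZMod 2) := Ψ.image Prod.fst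

/-- The form span `⟨L(Ψ)⟩`; its dimension is the rank of the system.
[Efremenko–Garlík–Itsykson 2024, §2.1 (`⟨L(Φ)⟩`, `rk`)] [cite: EfremenkoGarlikItsykson2024, §2.1] -/
def spanS (Ψ : AffSys V) : Submodule (ZMod 2) (V → ZMod 2) :=
  Submodule.span (ZMod 2) (forms Ψ : Set (V → ZMod 2))

omit [DecidableEq V] in
/-- Membership in the solution set. [folklore] -/
theorem mem_Sol {Ψ : AffSys V} {z : V → ZMod 2} : z ∈ Sol Ψ ↔ ∀ p ∈ Ψ, p.1 ⬝ᵥ z = p.2 :=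
  Iff.rfl

omit [DecidableEq V] in
/-- The solution set of a union is the intersection of the solution sets. [folklore] -/
theorem Sol_union (Ψ Ψ' : AffSys V) : Sol (Ψ ∪ Ψ') = Sol Ψ ∩ Sol Ψ' := by
  ext z
  simp only [Sol, Set.mem_setOf_eq, Set.mem_inter_iff, Finset.mem_union]
  constructor
  · intro h; exact ⟨fun p hp => h p (Or.inl hp), fun p hp => h p (Or.inr hp)⟩
  · rintro ⟨h1, h2⟩ p (hp | hp); exacts [h1 p hp, h2 p hp]

omit [DecidableEq V] in
/-- The form span of a union is the sup of the form spans. [folklore] -/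
theorem spanS_union (Ψ Ψ' : AffSys V) : spanS (Ψ ∪ Ψ') = spanS Ψ ⊔ spanS Ψ' := by
  unfold spanS forms
  rw [Finset.image_union, Finset.coe_union, Submodule.span_union]

omit [DecidableEq V] in
/-- A form of the system lies in the form span. [folklore] -/
theorem mem_spanS_of_mem_forms {Ψ : AffSys V} {f : V → ZMod 2} (h : f ∈ forms Ψ) :
    f ∈ spanS Ψ := Submodule.subset_span h

omit [DecidableEq V] in
/-- The form of an equation of the system lies in the form span. [folklore] -/
theorem mem_spanS_of_mem {Ψ : AffSys V} {p : (V → ZMod 2) × ZMod 2} (h : p ∈ Ψ) :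
    p.1 ∈ spanS Ψ := mem_spanS_of_mem_forms (Finset.mem_image_of_mem Prod.fst h)

omit [DecidableEq V] in
/-- Adding a vector orthogonal to all forms of `Ψ` to a solution gives a solution. [folklore] -/
theorem add_mem_Sol {Ψ : AffSys V} {z₀ w : V → ZMod 2} (h₀ : z₀ ∈ Sol Ψ)
    (hw : ∀ p ∈ Ψ, p.1 ⬝ᵥ w = 0) : z₀ + w ∈ Sol Ψ := by
  intro p hp
  rw [dotProduct_add, h₀ p hp, hw p hp, add_zero]

omit [DecidableEq V] in
/-- The CONSTANCY LEMMA: a form that is constant on the nonempty solution set of `Ψ` lies in the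
form span `⟨L(Ψ)⟩` (double annihilator in the finite-dimensional space `𝔽₂^V`, transported along
the dot-product duality `dotProductEquiv`). [Efremenko–Garlík–Itsykson 2024, §2.1 (a form is
determined on the solutions of `Φ` iff it lies in `⟨L(Φ)⟩`)] [cite: EfremenkoGarlikItsykson2024, §2.1] -/
theorem mem_spanS_of_constant {Ψ : AffSys V} {z₀ : V → ZMod 2} (h₀ : z₀ ∈ Sol Ψ)
    {f : V → ZMod 2} (hconst : ∀ z ∈ Sol Ψ, f ⬝ᵥ z = f ⬝ᵥ z₀) : f ∈ spanS Ψ := by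
  classical
  set E : (V → ZMod 2) ≃ₗ[ZMod 2] Module.Dual (ZMod 2) (V → ZMod 2) :=
    dotProductEquiv (ZMod 2) V with hE
  set W : Submodule (ZMod 2) (Module.Dual (ZMod 2) (V → ZMod 2)) :=
    (spanS Ψ).map (E : (V → ZMod 2) →ₗ[ZMod 2] Module.Dual (ZMod 2) (V → ZMod 2)) with hW
  have hWW : W.dualCoannihilator.dualAnnihilator = W :=
    Subspace.dualCoannihilator_dualAnnihilator_eq (W := W)
  have hEf : (E f : Module.Dual (ZMod 2) (V → ZMod 2)) ∈ W.dualCoannihilator.dualAnnihilator := by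
    rw [Submodule.mem_dualAnnihilator]
    intro w hw
    rw [Submodule.mem_dualCoannihilator] at hw
    have hz : z₀ + w ∈ Sol Ψ := by
      refine add_mem_Sol h₀ fun p hp => ?_
      have hφ : (E p.1 : Module.Dual (ZMod 2) (V → ZMod 2)) ∈ W :=
        Submodule.mem_map_of_mem (mem_spanS_of_mem hp)
      exact hw _ hφ
    have h1 := hconst _ hz
    rw [dotProduct_add, add_eq_left] at h1
    exact h1
  rw [hWW, hW, Submodule.mem_map] at hEf
  obtain ⟨g, hg, hgf⟩ := hEf
  have : g = f := E.injective hgf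
  rw [← this]
  exact hg

omit [DecidableEq V] in
/-- ONE-STEP EXTENSION: if `Ψ` is consistent and `f ∉ ⟨L(Ψ)⟩`, then `Ψ ∧ (f = c)` is consistent
for both values `c`. [Efremenko–Garlík–Itsykson 2024, §2.1] [cite: EfremenkoGarlikItsykson2024, §2.1] -/
theorem extend_consistent {Ψ : AffSys V} (hcons : (Sol Ψ).Nonempty)
    {f : V → ZMod 2} (hf : f ∉ spanS Ψ) (c : ZMod 2) :
    (Sol (Ψ ∪ {(f, c)})).Nonempty := by
  obtain ⟨z₀, hz₀⟩ := hcons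
  have hnc : ¬ (∀ z ∈ Sol Ψ, f ⬝ᵥ z = f ⬝ᵥ z₀) := fun h => hf (mem_spanS_of_constant hz₀ h)
  push Not at hnc
  obtain ⟨z₁, hz₁, hne⟩ := hnc
  have hcover : c = f ⬝ᵥ z₀ ∨ c = f ⬝ᵥ z₁ := by
    have h2 : ∀ a b c : ZMod 2, a ≠ b → c = a ∨ c = b := by decide
    exact h2 _ _ c (Ne.symm hne)
  have hmem : ∀ z ∈ Sol Ψ, f ⬝ᵥ z = c → z ∈ Sol (Ψ ∪ {(f, c)}) := by
    intro z hz hc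
    rw [Sol_union]
    refine ⟨hz, ?_⟩
    intro p hp
    rw [Finset.mem_singleton] at hp
    subst hp
    exact hc
  rcases hcover with h | h
  · exact ⟨z₀, hmem z₀ hz₀ h.symm⟩
  · exact ⟨z₁, hmem z₁ hz₁ h.symm⟩

/-! ### Coordinate subspaces `𝔽₂^A` -/

/-- The COORDINATE SUBSPACE `𝔽₂^A = {v : supp v ⊆ A}`. [folklore] -/
def coordS (A : Finset V) : Submodule (ZMod 2) (V → ZMod 2) where
  carrier := {v | ∀ i, i ∉ A → v i = 0}
  add_mem' := by
    intro f g hf hg i hi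
    simp only [Pi.add_apply]
    rw [hf i hi, hg i hi, add_zero]
  zero_mem' := fun _ _ => rfl
  smul_mem' := by
    intro c f hf i hi
    simp only [Pi.smul_apply]
    rw [hf i hi, smul_zero]

omit [Fintype V] [DecidableEq V] in
/-- Membership in `𝔽₂^A`. [folklore] -/
theorem mem_coordS {A : Finset V} {v : V → ZMod 2} :
    v ∈ coordS A ↔ ∀ i, i ∉ A → v i = 0 := Iff.rfl

omit [Fintype V] in
/-- Unit vectors on `A` lie in `𝔽₂^A`. [folklore] -/
theorem single_mem_coordS {A : Finset V} {i : V} (hi : i ∈ A) (c : ZMod 2) :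
    Pi.single i c ∈ coordS A := by
  intro k hk
  have hki : k ≠ i := fun h => hk (h ▸ hi)
  simp [hki]

omit [Fintype V] [DecidableEq V] in
/-- `𝔽₂^A` is monotone in `A`. [folklore] -/
theorem coordS_mono {A B : Finset V} (h : A ⊆ B) : coordS A ≤ coordS B :=
  fun _ hv i hi => hv i (fun hiA => hi (h hiA))

omit [Fintype V] [DecidableEq V] in
/-- `𝔽₂^∅ = 0`. [folklore] -/
theorem coordS_empty : coordS (∅ : Finset V) = ⊥ := by
  rw [Submodule.eq_bot_iff]
  intro v hv
  funext i
  exact hv i (Finset.notMem_empty i)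

omit [Fintype V] in
/-- `𝔽₂^{A ∪ B} = 𝔽₂^A + 𝔽₂^B`. [folklore] -/
theorem coordS_union (A B : Finset V) : coordS (A ∪ B) = coordS A ⊔ coordS B := by
  classical
  apply le_antisymm
  · intro v hv
    set u : V → ZMod 2 := fun i => if i ∈ A then v i else 0 with hu
    have hu_mem : u ∈ coordS A := by intro i hi; simp [hu, hi]
    have hw_mem : v - u ∈ coordS B := by
      intro i hi
      by_cases hA : i ∈ A
      · simp [hu, hA]
      · have hnu : i ∉ A ∪ B := by
          rw [Finset.mem_union]
          rintro (h | h); exacts [hA h, hi h]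
        have hv0 := hv i hnu
        simp [hu, hA, hv0]
    have hdecomp : v = u + (v - u) := by abel
    rw [hdecomp]
    exact Submodule.add_mem_sup hu_mem hw_mem
  · exact sup_le (coordS_mono Finset.subset_union_left)
      (coordS_mono Finset.subset_union_right)

/-- The unit vectors on `A` span `𝔽₂^A`. [folklore] -/
theorem span_singles (A : Finset V) :
    Submodule.span (ZMod 2)
      ((A.image (fun i => Pi.single i (1 : ZMod 2)) : Finset (V → ZMod 2)) :
        Set (V → ZMod 2)) = coordS A := by
  apply le_antisymm
  · rw [Submodule.span_le]
    intro v hv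
    rw [Finset.coe_image, Set.mem_image] at hv
    obtain ⟨i, hi, rfl⟩ := hv
    exact single_mem_coordS (Finset.mem_coe.mp hi) 1
  · intro v hv
    have hrepr : v = ∑ i ∈ A, Pi.single i (v i) := by
      funext k
      rw [Finset.sum_apply]
      by_cases hk : k ∈ A
      · rw [Finset.sum_eq_single k
          (fun b _ hb => by simp [Ne.symm hb])
          (fun hk' => absurd hk hk')]
        simp
      · rw [hv k hk]
        refine (Finset.sum_eq_zero (fun i hi => ?_)).symm
        have hki : k ≠ i := fun h => hk (by rw [h]; exact hi)
        simp [hki]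
    rw [hrepr]
    refine Submodule.sum_mem _ (fun i hi => ?_)
    have hsingle : Pi.single i (v i) = (v i) • (Pi.single i (1 : ZMod 2) : V → ZMod 2) := by
      funext k
      by_cases hk : k = i
      · subst hk; simp
      · simp [hk]
    rw [hsingle]
    refine Submodule.smul_mem _ _ (Submodule.subset_span ?_)
    rw [Finset.coe_image]
    exact Set.mem_image_of_mem _ (Finset.mem_coe.mpr hi)

/-- `dim 𝔽₂^A = |A|`. [folklore] -/
theorem finrank_coordS (A : Finset V) : finrank (ZMod 2) (coordS A) = A.card := by
  classical
  have hli : LinearIndependent (ZMod 2)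
      (fun i : {x // x ∈ A} => (Pi.single (i : V) (1 : ZMod 2) : V → ZMod 2)) := by
    have h := (Pi.basisFun (ZMod 2) V).linearIndependent
    have h' : LinearIndependent (ZMod 2) (fun i : V => (Pi.single i (1 : ZMod 2) : V → ZMod 2)) := by
      convert h using 1
      funext i
      rw [Pi.basisFun_apply]
    exact h'.comp _ Subtype.val_injective
  have hrange : Set.range (fun i : {x // x ∈ A} => (Pi.single (i : V) (1 : ZMod 2) : V → ZMod 2)) =
      ((A.image (fun i => Pi.single i (1 : ZMod 2)) : Finset (V → ZMod 2)) : Set (V → ZMod 2)) := by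
    rw [Finset.coe_image, Set.image_eq_range]
    rfl
  rw [← span_singles, ← hrange, finrank_span_eq_card hli, Fintype.card_coe]

omit [Fintype V] in
/-- `coordS` of a finite union, as a `Finset.sup`. [folklore] -/
theorem coordS_biUnion {α : Type*} [DecidableEq α] (s : Finset α) (f : α → Finset V) :
    coordS (s.biUnion f) = s.sup (fun j => coordS (f j)) := by
  classical
  induction s using Finset.induction_on with
  | empty => simp [coordS_empty]
  | insert a s ha ih => rw [Finset.biUnion_insert, coordS_union, ih, Finset.sup_insert]

/-! ### Clause sets: variable sets, satisfaction inside `Sol Ψ`, and the Rado deficiency -/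

section Clauses

variable {ι : Type*} [DecidableEq ι] (T : ι → Finset V) (a : ι → V → ZMod 2)

/-- `V(I)`: the variable set of the clause set `I` (union of the scopes). [folklore] -/
def VI (I : Finset ι) : Finset V := I.biUnion T

omit [Fintype V] in
/-- `V(I ∪ J) = V(I) ∪ V(J)`. [folklore] -/
theorem VI_union (I J : Finset ι) : VI T (I ∪ J) = VI T I ∪ VI T J := by
  ext x
  simp only [VI, Finset.mem_biUnion, Finset.mem_union]
  constructor
  · rintro ⟨j, hj | hj, hx⟩
    · exact Or.inl ⟨j, hj, hx⟩
    · exact Or.inr ⟨j, hj, hx⟩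
  · rintro (⟨j, hj, hx⟩ | ⟨j, hj, hx⟩)
    · exact ⟨j, Or.inl hj, hx⟩
    · exact ⟨j, Or.inr hj, hx⟩

omit [Fintype V] [DecidableEq ι] in
/-- `V` is monotone. [folklore] -/
theorem VI_mono {I J : Finset ι} (h : I ⊆ J) : VI T I ⊆ VI T J := by
  intro x hx
  rw [VI, Finset.mem_biUnion] at hx ⊢
  obtain ⟨j, hj, hx⟩ := hx
  exact ⟨j, h hj, hx⟩

omit [Fintype V] [DecidableEq ι] in
/-- Each scope of `I` lies in `V(I)`. [folklore] -/
theorem subset_VI {I : Finset ι} {j : ι} (hj : j ∈ I) : T j ⊆ VI T I :=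
  fun _ hi => Finset.mem_biUnion.mpr ⟨j, hj, hi⟩

/-- `z` SATISFIES every clause of `I`: for each `j ∈ I` it differs from the forbidden pattern
`a j` somewhere on the scope `T j` (a clause is falsified exactly by the assignments agreeing with
its forbidden pattern on its variables). [folklore] -/
def SatOn (I : Finset ι) (z : V → ZMod 2) : Prop := ∀ j ∈ I, ∃ i ∈ T j, z i ≠ a j i

/-- `I` is `Ψ`-SATISFIABLE: some solution of `Ψ` satisfies all clauses of `I`. [folklore] -/
def PsiSat (Ψ : AffSys V) (I : Finset ι) : Prop := ∃ z ∈ Sol Ψ, SatOn T a I z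

/-- `X` is MINIMALLY `Ψ`-UNSATISFIABLE: not `Ψ`-satisfiable, but every proper subset is.
[folklore] -/
def MinimalPsiUnsat (Ψ : AffSys V) (X : Finset ι) : Prop :=
  ¬ PsiSat T a Ψ X ∧ ∀ J ⊂ X, PsiSat T a Ψ J

/-- The RADO DEFICIENCY of a clause set relative to a subspace `S ≤ 𝔽₂^V`:
`δ_S(I) = |I| - |V(I)| + dim(S ∩ 𝔽₂^{V(I)})`, i.e. `|I|` minus the rank of `V(I)` in the
quotient matroid `𝔽₂^V/S`, as an integer. [Welsh 1976, Ch. 7 (deficiency)] [folklore] -/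
noncomputable def deltaS (S : Submodule (ZMod 2) (V → ZMod 2)) (I : Finset ι) : ℤ :=
  (I.card : ℤ) - ((VI T I).card : ℤ) +
    (finrank (ZMod 2) (S ⊓ coordS (VI T I) : Submodule (ZMod 2) (V → ZMod 2)) : ℤ)

omit [DecidableEq ι] in
/-- The sup form of the deficiency: `δ_S(I) = |I| + dim S - dim(S + 𝔽₂^{V(I)})`. [folklore] -/
theorem deltaS_eq_sup (S : Submodule (ZMod 2) (V → ZMod 2)) (I : Finset ι) :
    deltaS T S I =
      (I.card : ℤ) + (finrank (ZMod 2) S : ℤ) -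
        (finrank (ZMod 2) (S ⊔ coordS (VI T I) : Submodule (ZMod 2) (V → ZMod 2)) : ℤ) := by
  have h := Submodule.finrank_sup_add_finrank_inf_eq S (coordS (VI T I))
  have h2 := finrank_coordS (VI T I)
  unfold deltaS
  omega

omit [Fintype V] [DecidableEq ι] in
/-- `δ_S(∅) = 0`. [folklore] -/
theorem deltaS_empty (S : Submodule (ZMod 2) (V → ZMod 2)) : deltaS T S (∅ : Finset ι) = 0 := by
  have hVI : VI T (∅ : Finset ι) = ∅ := by
    ext x; simp [VI]
  unfold deltaS
  rw [hVI, coordS_empty, inf_bot_eq]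
  simp

/-- CONTRACTION: for disjoint `I`, `J`, `δ_{S + 𝔽₂^{V(I)}}(J) = δ_S(I ∪ J) - δ_S(I)`. [folklore] -/
theorem deltaS_contract (S : Submodule (ZMod 2) (V → ZMod 2)) {I J : Finset ι}
    (hdisj : Disjoint I J) :
    deltaS T (S ⊔ coordS (VI T I)) J = deltaS T S (I ∪ J) - deltaS T S I := by
  classical
  rw [deltaS_eq_sup, deltaS_eq_sup, deltaS_eq_sup]
  have hsupEq : S ⊔ coordS (VI T (I ∪ J)) = (S ⊔ coordS (VI T I)) ⊔ coordS (VI T J) := by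
    rw [VI_union, coordS_union, sup_assoc]
  have hsup' : finrank (ZMod 2) (S ⊔ coordS (VI T (I ∪ J)) : Submodule (ZMod 2) (V → ZMod 2)) =
      finrank (ZMod 2) ((S ⊔ coordS (VI T I)) ⊔ coordS (VI T J) :
        Submodule (ZMod 2) (V → ZMod 2)) := by rw [hsupEq]
  have hcard : (I ∪ J).card = I.card + J.card := Finset.card_union_of_disjoint hdisj
  omega

end Clauses

end AffSys

end Literature.Computability.MetaComplexity
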